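import Summits.BirchSwinnertonDyer.BirchSwinnertonDyer.Theorems.CyclotomicUntwistPSLocalThreeTorsionValued
import Summits.BirchSwinnertonDyer.BirchSwinnertonDyer.Theorems.CyclotomicUntwistPSKodairaDictionary
import Literature.NumberTheory.EllipticCurves.OggFormulaWildTypesKodairaProofs
import HarnessLib

/-!
# LAW L-t3, part 1: Kodaira `IV*` with `v₃(Δ_min) = 10` or `II*` with `v₃(Δ_min) = 12` at `3` ⟹
# `W(ℚ₃)[3] = 0` (`NoLocalThreeTorsionAt W 3`) — the `η`-order-`6` / order-`3` UPPER rows of the cyclic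
# wild cell of route `CyclotomicUntwist` carry NO `ℚ₃`-rational `3`-torsion, whatever `c₃` is

Cell `pub/bsd-wall` (D-0145 line `route-BirchSwinnertonDyer-CyclotomicUntwist`), seat `bsd-line-cycu-p2`
(prover seat 2/3, gen 3), helper toward K1 `PSRankOneLowerHalfAtThree` (stmt-BirchSwinnertonDyer-21580) and
K2 `PSRankOneUpperHalfAtThree` (stmt-21581): the local condition at `3` of any `3`-descent on the
principal-series rows (`dim E(ℚ₃)/3 = 1 + dim E(ℚ₃)[3]`). THEOREMS ONLY (no definition, no named fact, no
`sorry`); BSD is not proved by this file and no crux is. Companion of this seat's LAW L-c3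
(`CyclotomicUntwistPSTamagawaThreeLaw.lean`, p601441: `c₃ = 3 ⟺ (Δ_min/3¹⁰)(c₆/3⁶) ≡ 1 (mod 3)` on the
`IV*` rows): at the prime `3` itself the O6 law "`E(ℚ_q)[3] ≠ 0 ⟺ c_q = 3`" of the tree
(`localThreeTorsionIffTamagawaThreeOfIV_holds`, `q ≠ 3`) FAILS on the `IV*` rows — `c₃ = 3` occurs (census:
224 of the 244 onto PS rank-1 `IV*` classes) but `W(ℚ₃)[3] = 0` always. Template and tools: the O5 file
`O5/NoLocalThreeTorsionIIIstar.lean` (Kodaira `III*`), whose valued-field lemmas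
(`NonSplitAtThree.map_root_eq_one_of_shapeIII`, `map_Ψ₂Sq_eq_one_of_shapeIII`, `eval_Ψ₂Sq_variableChange`,
`sq_ne_exp_neg_three`) are consumed by name.

## What is proved (`w` a `ℤᵐ⁰`-valuation with `w 3 = exp(−1)`; `Ψ₃ = 3x⁴ + b₂x³ + 3b₄x² + 3b₆x + b₈`,
## `Ψ₂² = 4x³ + b₂x² + 2b₄x + b₆`)

* §1 = the valued-field layer `CyclotomicUntwistPSLocalThreeTorsionValued.lean` (this seat):
  `map_b₈_of_shapeIVstar_ten` (`w b₈ = e⁻⁶` on the `IV*` shape with `w Δ = e⁻¹⁰`),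
  `map_b₂_b₈_of_shapeIIstar_twelve` (`w b₂ ≤ e⁻³`, `w b₈ ≤ e⁻⁸` on the `II*` shape with `w Δ = e⁻¹²`),
  `map_lt_one_of_root_of_lt_one`, `sq_ne_exp_of_odd`.
* §2 over the completion `K_v` (`3 = π` a uniformiser): `eval_Ψ₂Sq_ne_sq_of_shapeIVstar_ten` — on the
  `IV*` model with `v(Δ) = 10`, the rescaling `z = πr` lands on the type-III shape (`b₂/π, b₄/π², b₆/π³ ∈ π𝒪`,
  `w(b₈/π⁴) = e⁻²`), so every root `z` of `Ψ₃` has `w z = e⁻¹` and `Ψ₂²(z) = π³·unit`: valuation `e⁻³`, odd,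
  not a square; `eval_Ψ₂Sq_ne_sq_of_shapeIIstar_twelve` — on the `II*` model with `v(Δ) = 12`, `Ψ₃(πr)/π⁵`
  is monic in `r` with coefficients in `π𝒪`, so every root has `w z ≤ e⁻²`, and then `b₆` dominates:
  `w Ψ₂²(z) = e⁻⁵`, odd.
* §3 curves over `ℚ`: **`noLocalThreeTorsionAt_three_of_kodairaIVstar_ten`** (`K₃ = IV*`, `v₃Δ_min = 10`),
  **`noLocalThreeTorsionAt_three_of_kodairaIIstar_twelve`** (`K₃ = II*`, `v = 12`), their point readings
  `W(ℚ₃)[3] = 0` (E111 `noLocalThreeTorsionAt_iff_forall_three_nsmul`), and the census spellings on the wild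
  cell (`ClassO6 W 3`, `v ∈ {10, 12}`; `PSKodairaDictionary.kodairaSymbolAt_of_mod_four_eq_two /
  _of_four_dvd`). Numerics (this seat, `census/lt3_check.py`, exact 3-adic root isolation): 0 of the
  280 + 177 curves with `81 ∥ N < 10⁴`, `v ∈ {10, 12}` have `E(ℚ₃)[3] ≠ 0` — EVIDENCE only.

References: J. H. Silverman, *Advanced Topics in the Arithmetic of Elliptic Curves* (1994), IV.9.4 Steps 8,
10 and Table 4.1 [SilvermanATAEC1994]; *The Arithmetic of Elliptic Curves* (2009), III.2.3 (d), Ex. 3.7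
[SilvermanAEC2009]; I. Papadopoulos, J. Number Theory 44 (1993), Table (p = 3) [Papadopoulos1993].
-/

set_option autoImplicit false
-- single-conjunct summit: `Summit.BirchSwinnertonDyer.BirchSwinnertonDyer.…` repeats the name by design
set_option linter.dupNamespace false

noncomputable section

open scoped Classical

open Polynomial WeierstrassCurve IsDedekindDomain IsDedekindDomain.HeightOneSpectrum WithZero
  Rat.HeightOneSpectrum Literature.NumberTheory.EllipticCurves
  Literature.NumberTheory.EllipticCurves.Rank1Residual Literature.NumberTheory.DiophantineGeometry
  Summit.BirchSwinnertonDyer.Rank1Residual.Additive Summit.BirchSwinnertonDyer.Rank1Residual.O5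
  Summit.BirchSwinnertonDyer.Rank1Residual.O5.NonSplitAtThree

open Summit.BirchSwinnertonDyer.Rank1Residual.Additive.ThreeAdicLift (le_exp_sub_one_of_lt_exp)

namespace Summit.BirchSwinnertonDyer.BirchSwinnertonDyer.Theorems.PSLocalThreeTorsion

/-! ## §2 Curves over the completion `K_v` (`3` a uniformiser): `Ψ₂²` at a root of `Ψ₃` -/

section Completion

variable {A : Type*} [CommRing A] [IsDedekindDomain A] {K : Type*} [Field K] [Algebra A K]
  [IsFractionRing A K] (v : HeightOneSpectrum A)

/-- **Type `IV*` with `v(Δ) = 10`: at every `K_v`-root of `Ψ₃`, `Ψ₂²` is NOT a square.** On a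
`K_v`-model with `b₂ = π²β₂`, `b₄ = π³β₄`, `b₆ = π⁴β₆` (`β₆` a unit; Tate's Step-8 normal form) and
`Δ = π¹⁰δ` (`δ` a unit), `π = 3`: `w b₈ = e⁻⁶` (§1), the rescaling `z = πr` lands on the type-III shape of
`NonSplitAtThree.map_root_eq_one_of_shapeIII`, so `w z = e⁻¹`, and `Ψ₂²(z) = π³·unit` has the odd
valuation `exp (−3)`. [cite: SilvermanATAEC1994, IV.9.4 Step 8 (normal form of type IV*)] -/
theorem eval_Ψ₂Sq_ne_sq_of_shapeIVstar_ten {π : K} (hπ : v.valuation K π = exp (-1 : ℤ))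
    (h3 : (π : v.adicCompletion K) = 3) (N : WeierstrassCurve (v.adicCompletion K))
    (β₂ β₄ β₆ δ : v.adicCompletionIntegers K) (hβ₆ : IsUnit β₆) (hδ : IsUnit δ)
    (hb₂ : N.b₂ = (π : v.adicCompletion K) ^ 2 * β₂)
    (hb₄ : N.b₄ = (π : v.adicCompletion K) ^ 3 * β₄)
    (hb₆ : N.b₆ = (π : v.adicCompletion K) ^ 4 * β₆)
    (hΔ : N.Δ = (π : v.adicCompletion K) ^ 10 * δ) (z t : v.adicCompletion K)
    (hz : N.Ψ₃.eval z = 0) : N.Ψ₂Sq.eval z ≠ t ^ 2 := by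
  set w : Valuation (v.adicCompletion K) ℤᵐ⁰ := Valued.v with hw
  set ϖ : v.adicCompletion K := (π : v.adicCompletion K) with hϖ
  have hπv : w ϖ = exp (-1 : ℤ) := by rw [hw, hϖ, valuedAdicCompletion_eq_valuation', hπ]
  have hϖ0 : ϖ ≠ 0 := by
    intro h0; rw [h0, map_zero] at hπv; exact exp_ne_zero hπv.symm
  have hint : ∀ β : v.adicCompletionIntegers K, w (β : v.adicCompletion K) ≤ 1 := fun β ↦ β.2
  have hunit : ∀ {β : v.adicCompletionIntegers K}, IsUnit β → w (β : v.adicCompletion K) = 1 :=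
    fun hβ ↦ valued_coe_eq_one_of_isUnit v hβ
  have h3' : (3 : v.adicCompletion K) = ϖ := h3.symm
  have hpowle : ∀ (n : ℕ) (β : v.adicCompletionIntegers K),
      w (ϖ ^ n * (β : v.adicCompletion K)) ≤ exp (-(n : ℤ)) := by
    intro n β
    rw [map_mul, map_pow, hπv, ← exp_nsmul]
    calc exp (n • (-1 : ℤ)) * w (β : v.adicCompletion K) ≤ exp (n • (-1 : ℤ)) * 1 :=
        mul_le_mul' le_rfl (hint β)
      _ = exp (-(n : ℤ)) := by simp
  have hpoweq : ∀ (n : ℕ) {β : v.adicCompletionIntegers K}, IsUnit β →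
      w (ϖ ^ n * (β : v.adicCompletion K)) = exp (-(n : ℤ)) := by
    intro n β hβ
    rw [map_mul, map_pow, hπv, ← exp_nsmul, hunit hβ, mul_one]; simp
  have wb₂ : w N.b₂ ≤ exp (-2 : ℤ) := by rw [hb₂]; exact hpowle 2 β₂
  have wb₄ : w N.b₄ ≤ exp (-3 : ℤ) := by rw [hb₄]; exact hpowle 3 β₄
  have wb₆ : w N.b₆ = exp (-4 : ℤ) := by rw [hb₆]; exact hpoweq 4 hβ₆
  have wΔ : w (-N.b₂ ^ 2 * N.b₈ - 8 * N.b₄ ^ 3 - 27 * N.b₆ ^ 2 + 9 * N.b₂ * N.b₄ * N.b₆) =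
      exp (-10 : ℤ) := by
    rw [show -N.b₂ ^ 2 * N.b₈ - 8 * N.b₄ ^ 3 - 27 * N.b₆ ^ 2 + 9 * N.b₂ * N.b₄ * N.b₆ = N.Δ from rfl,
      hΔ]
    exact hpoweq 10 hδ
  have wb₈ : w N.b₈ = exp (-6 : ℤ) := map_b₈_of_shapeIVstar_ten w h3' hπv wb₂ wb₄ wb₆ N.b_relation wΔ
  -- the rescaled invariants `cᵢ = bᵢ / ϖ^{i/2}` are on the type-III shape
  set c₂ : v.adicCompletion K := N.b₂ / ϖ with hc₂
  set c₄ : v.adicCompletion K := N.b₄ / ϖ ^ 2 with hc₄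
  set c₆ : v.adicCompletion K := N.b₆ / ϖ ^ 3 with hc₆
  set c₈ : v.adicCompletion K := N.b₈ / ϖ ^ 4 with hc₈
  have wdivid : ∀ (x : v.adicCompletion K) (n : ℕ), w (x / ϖ ^ n) = w x * exp (n : ℤ) := by
    intro x n
    rw [map_div₀, map_pow, hπv, ← exp_nsmul, div_eq_mul_inv, ← exp_neg]
    congr 2
    simp
  have wdiv : ∀ (x : v.adicCompletion K) (n : ℕ) (a b : ℤ), a + n = b → w x ≤ exp a →
      w (x / ϖ ^ n) ≤ exp b := by
    intro x n a b hab hx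
    rw [wdivid, ← hab, exp_add]
    exact mul_le_mul' hx le_rfl
  have wdiveq : ∀ (x : v.adicCompletion K) (n : ℕ) (a b : ℤ), a + n = b → w x = exp a →
      w (x / ϖ ^ n) = exp b := by
    intro x n a b hab hx
    rw [wdivid, ← hab, exp_add, hx]
  have wc₂ : w c₂ ≤ exp (-1 : ℤ) := by
    have h := wdiv N.b₂ 1 (-2) (-1) (by norm_num) wb₂
    rwa [pow_one] at h
  have wc₄ : w c₄ ≤ exp (-1 : ℤ) := wdiv N.b₄ 2 (-3) (-1) (by norm_num) wb₄
  have wc₆ : w c₆ ≤ exp (-1 : ℤ) := (wdiveq N.b₆ 3 (-4) (-1) (by norm_num) wb₆).le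
  have wc₈ : w c₈ = exp (-2 : ℤ) := wdiveq N.b₈ 4 (-6) (-2) (by norm_num) wb₈
  have hresc : 3 * (z / ϖ) ^ 4 + c₂ * (z / ϖ) ^ 3 + 3 * c₄ * (z / ϖ) ^ 2 + 3 * c₆ * (z / ϖ) + c₈ = 0 := by
    rw [WeierstrassCurve.eval_Ψ₃_eq] at hz
    have h : 3 * (z / ϖ) ^ 4 + c₂ * (z / ϖ) ^ 3 + 3 * c₄ * (z / ϖ) ^ 2 + 3 * c₆ * (z / ϖ) + c₈ =
        (3 * z ^ 4 + N.b₂ * z ^ 3 + 3 * N.b₄ * z ^ 2 + 3 * N.b₆ * z + N.b₈) / ϖ ^ 4 := by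
      rw [hc₈, hc₂, hc₆, hc₄]
      field_simp
    rw [h, hz, zero_div]
  have hr1 : w (z / ϖ) = 1 := map_root_eq_one_of_shapeIII w h3' hπv wc₂ wc₄ wc₆ wc₈ hresc
  have hfac : N.Ψ₂Sq.eval z =
      ϖ ^ 3 * (4 * (z / ϖ) ^ 3 + c₂ * (z / ϖ) ^ 2 + 2 * c₄ * (z / ϖ) + c₆) := by
    rw [eval_Ψ₂Sq_eq, hc₂, hc₆, hc₄]
    field_simp
  have wval : w (N.Ψ₂Sq.eval z) = exp (-3 : ℤ) := by
    rw [hfac, map_mul, map_pow, hπv, map_Ψ₂Sq_eq_one_of_shapeIII w h3' hπv wc₂ wc₄ wc₆ hr1,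
      mul_one, ← exp_nsmul]
    simp
  intro hsq
  have hne := sq_ne_exp_neg_three (w t)
  rw [← map_pow, ← hsq, wval] at hne
  exact hne rfl

/-- **Type `II*` with `v(Δ) = 12`: at every `K_v`-root of `Ψ₃`, `Ψ₂²` is NOT a square.** On a
`K_v`-model with `b₂ = π²β₂`, `b₄ = π⁴β₄`, `b₆ = π⁵β₆` (`β₆` a unit; Tate's Step-10 normal form) and
`Δ = π¹²δ`, `π = 3`: `w b₂ ≤ e⁻³`, `w b₈ ≤ e⁻⁸` (§1); `Ψ₃(πr)/π⁵` is monic in `r` with coefficients in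
`π𝒪`, so every root has `w z ≤ e⁻²`, and then `b₆` dominates `Ψ₂²(z) = 4z³ + b₂z² + 2b₄z + b₆`:
valuation `exp (−5)`, odd. [cite: SilvermanATAEC1994, IV.9.4 Step 10 (normal form of type II*)] -/
theorem eval_Ψ₂Sq_ne_sq_of_shapeIIstar_twelve {π : K} (hπ : v.valuation K π = exp (-1 : ℤ))
    (h3 : (π : v.adicCompletion K) = 3) (N : WeierstrassCurve (v.adicCompletion K))
    (β₂ β₄ β₆ δ : v.adicCompletionIntegers K) (hβ₆ : IsUnit β₆) (hδ : IsUnit δ)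
    (hb₂ : N.b₂ = (π : v.adicCompletion K) ^ 2 * β₂)
    (hb₄ : N.b₄ = (π : v.adicCompletion K) ^ 4 * β₄)
    (hb₆ : N.b₆ = (π : v.adicCompletion K) ^ 5 * β₆)
    (hΔ : N.Δ = (π : v.adicCompletion K) ^ 12 * δ) (z t : v.adicCompletion K)
    (hz : N.Ψ₃.eval z = 0) : N.Ψ₂Sq.eval z ≠ t ^ 2 := by
  set w : Valuation (v.adicCompletion K) ℤᵐ⁰ := Valued.v with hw
  set ϖ : v.adicCompletion K := (π : v.adicCompletion K) with hϖ
  have hπv : w ϖ = exp (-1 : ℤ) := by rw [hw, hϖ, valuedAdicCompletion_eq_valuation', hπ]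
  have hϖ0 : ϖ ≠ 0 := by
    intro h0; rw [h0, map_zero] at hπv; exact exp_ne_zero hπv.symm
  have hint : ∀ β : v.adicCompletionIntegers K, w (β : v.adicCompletion K) ≤ 1 := fun β ↦ β.2
  have hunit : ∀ {β : v.adicCompletionIntegers K}, IsUnit β → w (β : v.adicCompletion K) = 1 :=
    fun hβ ↦ valued_coe_eq_one_of_isUnit v hβ
  have h3' : (3 : v.adicCompletion K) = ϖ := h3.symm
  obtain ⟨w4, -, w2, -, -⟩ := map_consts w h3' hπv
  have hpowle : ∀ (n : ℕ) (β : v.adicCompletionIntegers K),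
      w (ϖ ^ n * (β : v.adicCompletion K)) ≤ exp (-(n : ℤ)) := by
    intro n β
    rw [map_mul, map_pow, hπv, ← exp_nsmul]
    calc exp (n • (-1 : ℤ)) * w (β : v.adicCompletion K) ≤ exp (n • (-1 : ℤ)) * 1 :=
        mul_le_mul' le_rfl (hint β)
      _ = exp (-(n : ℤ)) := by simp
  have hpoweq : ∀ (n : ℕ) {β : v.adicCompletionIntegers K}, IsUnit β →
      w (ϖ ^ n * (β : v.adicCompletion K)) = exp (-(n : ℤ)) := by
    intro n β hβ
    rw [map_mul, map_pow, hπv, ← exp_nsmul, hunit hβ, mul_one]; simp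
  have wb₂ : w N.b₂ ≤ exp (-2 : ℤ) := by rw [hb₂]; exact hpowle 2 β₂
  have wb₄ : w N.b₄ ≤ exp (-4 : ℤ) := by rw [hb₄]; exact hpowle 4 β₄
  have wb₆ : w N.b₆ = exp (-5 : ℤ) := by rw [hb₆]; exact hpoweq 5 hβ₆
  have wΔ : w (-N.b₂ ^ 2 * N.b₈ - 8 * N.b₄ ^ 3 - 27 * N.b₆ ^ 2 + 9 * N.b₂ * N.b₄ * N.b₆) =
      exp (-12 : ℤ) := by
    rw [show -N.b₂ ^ 2 * N.b₈ - 8 * N.b₄ ^ 3 - 27 * N.b₆ ^ 2 + 9 * N.b₂ * N.b₄ * N.b₆ = N.Δ from rfl,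
      hΔ]
    exact hpoweq 12 hδ
  obtain ⟨wb₂', wb₈⟩ := map_b₂_b₈_of_shapeIIstar_twelve w h3' hπv wb₂ wb₄ wb₆ N.b_relation wΔ
  have wdivid : ∀ (x : v.adicCompletion K) (n : ℕ), w (x / ϖ ^ n) = w x * exp (n : ℤ) := by
    intro x n
    rw [map_div₀, map_pow, hπv, ← exp_nsmul, div_eq_mul_inv, ← exp_neg]
    congr 2
    simp
  have wdivlt : ∀ (x : v.adicCompletion K) (n : ℕ) (a : ℤ), w x ≤ exp a → a + n < 0 →
      w (x / ϖ ^ n) < 1 := by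
    intro x n a hx hlt
    rw [wdivid]
    calc w x * exp (n : ℤ) ≤ exp a * exp (n : ℤ) := mul_le_mul' hx le_rfl
      _ = exp (a + n) := by rw [← exp_add]
      _ < 1 := by rw [← exp_zero, exp_lt_exp]; exact hlt
  -- every root has `w z ≤ e⁻²`: `Ψ₃(ϖ r)/ϖ⁵` is monic in `r = z/ϖ` with coefficients in `ϖ𝒪`
  have hz' : (z / ϖ) ^ 4 + N.b₂ / ϖ ^ 2 * (z / ϖ) ^ 3 + N.b₄ / ϖ ^ 2 * (z / ϖ) ^ 2 +
      N.b₆ / ϖ ^ 3 * (z / ϖ) + N.b₈ / ϖ ^ 5 = 0 := by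
    rw [WeierstrassCurve.eval_Ψ₃_eq] at hz
    have h : (z / ϖ) ^ 4 + N.b₂ / ϖ ^ 2 * (z / ϖ) ^ 3 + N.b₄ / ϖ ^ 2 * (z / ϖ) ^ 2 +
        N.b₆ / ϖ ^ 3 * (z / ϖ) + N.b₈ / ϖ ^ 5 =
        (3 * z ^ 4 + N.b₂ * z ^ 3 + 3 * N.b₄ * z ^ 2 + 3 * N.b₆ * z + N.b₈) / ϖ ^ 5 := by
      rw [h3']
      field_simp
    rw [h, hz, zero_div]
  have hr : w (z / ϖ) < 1 :=
    map_lt_one_of_root_of_lt_one w (wdivlt N.b₂ 2 (-3) wb₂' (by norm_num))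
      (wdivlt N.b₄ 2 (-4) wb₄ (by norm_num)) (wdivlt N.b₆ 3 (-5) wb₆.le (by norm_num))
      (wdivlt N.b₈ 5 (-8) wb₈ (by norm_num)) hz'
  have wz : w z ≤ exp (-2 : ℤ) := by
    have h1 : w (z / ϖ) ≤ exp (-1 : ℤ) := by
      have := le_exp_sub_one_of_lt_exp (n := 0) (by rwa [exp_zero])
      rwa [show (0 : ℤ) - 1 = -1 by norm_num] at this
    have hz1 : z = ϖ * (z / ϖ) := by field_simp
    rw [hz1, map_mul, hπv]
    calc exp (-1 : ℤ) * w (z / ϖ) ≤ exp (-1 : ℤ) * exp (-1 : ℤ) := mul_le_mul' le_rfl h1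
      _ = exp (-2 : ℤ) := by rw [← exp_add]; norm_num
  -- `b₆` dominates `Ψ₂²(z)`
  have hS : w (4 * z ^ 3 + N.b₂ * z ^ 2 + 2 * N.b₄ * z) ≤ exp (-6 : ℤ) := by
    refine Valuation.map_add_le w (Valuation.map_add_le w ?_ ?_) ?_
    · rw [map_mul, map_pow, w4, one_mul]
      calc w z ^ 3 ≤ exp (-2 : ℤ) ^ 3 := pow_le_pow_left' wz 3
        _ = exp (-6 : ℤ) := by rw [← exp_nsmul]; norm_num
    · rw [map_mul, map_pow]
      calc w N.b₂ * w z ^ 2 ≤ exp (-3 : ℤ) * exp (-2 : ℤ) ^ 2 := mul_le_mul' wb₂' (pow_le_pow_left' wz 2)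
        _ ≤ exp (-6 : ℤ) := by rw [← exp_nsmul, ← exp_add, exp_le_exp]; norm_num
    · rw [map_mul, map_mul]
      calc w 2 * w N.b₄ * w z ≤ 1 * exp (-4 : ℤ) * exp (-2 : ℤ) := mul_le_mul' (mul_le_mul' w2 wb₄) wz
        _ = exp (-6 : ℤ) := by rw [one_mul, ← exp_add]; norm_num
  have lS : w (4 * z ^ 3 + N.b₂ * z ^ 2 + 2 * N.b₄ * z) < w N.b₆ := by
    rw [wb₆]; exact lt_of_le_of_lt hS (by rw [exp_lt_exp]; norm_num)
  have wval : w (N.Ψ₂Sq.eval z) = exp (-5 : ℤ) := by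
    rw [eval_Ψ₂Sq_eq, Valuation.map_add_eq_of_lt_right w lS, wb₆]
  intro hsq
  have hne := sq_ne_exp_of_odd (w t) (n := -5) ⟨-3, by norm_num⟩
  rw [← map_pow, ← hsq, wval] at hne
  exact hne rfl

end Completion

/-! ## §3 Curves over `ℚ`: Kodaira `IV*` (`v = 10`) / `II*` (`v = 12`) at `3` ⟹ `W(ℚ₃)[3] = 0` -/

section Curves

variable (W : WeierstrassCurve ℚ) [W.IsElliptic]

omit [W.IsElliptic] in
/-- The transport `ℚ_[3] ≃ ℚ_{(3)}` of a root of `Ψ₃` and a square value of `Ψ₂²`, to a `K_v`-model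
`C • W ⊗ K_v` (as in the O5 `III*` file). [folklore] -/
theorem transport_root_sq (C : VariableChange ((placeOf 3).adicCompletion ℚ)) (x₀ s : ℚ_[3])
    (hx : ((W.baseChange ℚ_[3]).Ψ₃).IsRoot x₀) (hs : ((W.baseChange ℚ_[3]).Ψ₂Sq).eval x₀ = s ^ 2) :
    ∃ z t : (placeOf 3).adicCompletion ℚ,
      (C • W.baseChange ((placeOf 3).adicCompletion ℚ)).Ψ₃.eval z = 0 ∧
      (C • W.baseChange ((placeOf 3).adicCompletion ℚ)).Ψ₂Sq.eval z = t ^ 2 := by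
  set Kv := (placeOf 3).adicCompletion ℚ
  let e : ℚ_[3] ≃ₐ[ℚ] Kv := (Padic.adicCompletionEquiv ℤ ⟨3, Nat.prime_three⟩).toAlgEquiv
  have hx' : (W.baseChange Kv).Ψ₃.eval (e x₀) = 0 := by
    rw [IsRoot.def, WeierstrassCurve.baseChange, map_Ψ₃, eval_map, ← aeval_def] at hx
    rw [WeierstrassCurve.baseChange, map_Ψ₃, eval_map, ← aeval_def, aeval_algHom_apply, hx, map_zero]
  have hs' : (W.baseChange Kv).Ψ₂Sq.eval (e x₀) = e s ^ 2 := by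
    rw [WeierstrassCurve.baseChange, map_Ψ₂Sq, eval_map, ← aeval_def] at hs
    rw [WeierstrassCurve.baseChange, map_Ψ₂Sq, eval_map, ← aeval_def, aeval_algHom_apply, hs, map_pow]
  refine ⟨(C.u⁻¹ : Kvˣ) ^ 2 * (e x₀ - C.r), (C.u⁻¹ : Kvˣ) ^ 3 * e s, ?_, ?_⟩
  · rw [eval_Ψ₃_variableChange, hx', mul_zero]
  · rw [eval_Ψ₂Sq_variableChange, hs']
    ring

/-- **Kodaira `IV*` at `3` with `ord₃ Δ_min = 10` ⟹ `NoLocalThreeTorsionAt W 3`** — no `ℚ₃`-root `x₀` of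
`Ψ₃` has `Ψ₂²(x₀)` a square in `ℚ₃`. Tate's Step-8 normal form over `ℚ_{(3)}` (Literature
`exists_variableChange_b_of_kodairaSymbolAt_wild`) feeds §2. [cite: SilvermanATAEC1994, IV.9.4 Step 8 and Table 4.1] -/
theorem noLocalThreeTorsionAt_three_of_kodairaIVstar_ten
    (hT : W.kodairaSymbolAt (placeOf 3) = .IVstar) (hord : W.ordMinimalDiscriminant (placeOf 3) = 10) :
    NoLocalThreeTorsionAt W 3 := by
  haveI : PerfectField (IsLocalRing.ResidueField ((placeOf 3).adicCompletionIntegers ℚ)) :=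
    PerfectField.ofFinite
  have h2 : ringChar (ℤ ⧸ (placeOf 3).asIdeal) ≠ 2 := by rw [ringChar_int_quot_placeOf 3]; decide
  have hgen : natGenerator (placeOf 3) = 3 :=
    Literature.NumberTheory.EllipticCurves.Rat.natGenerator_primesEquiv_symm ⟨3, Nat.prime_three⟩
  have hπ : (placeOf 3).valuation ℚ (3 : ℚ) = exp (-1 : ℤ) := by
    have h := valuation_natGenerator_int (placeOf 3)
    rwa [hgen, Nat.cast_ofNat] at h
  have h3 : algebraMap ℚ ((placeOf 3).adicCompletion ℚ) 3 = 3 := map_ofNat _ 3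
  obtain ⟨C, β₂, β₄, β₆, δ, hβ₆, hδ, hb₂, hb₄, hb₆, hΔ⟩ :=
    W.exists_variableChange_b_of_kodairaSymbolAt_wild (placeOf 3) h2
      (Or.inr (Or.inr (Or.inl ⟨hT, rfl, rfl, rfl⟩))) hπ
  rw [hord] at hΔ
  intro x₀ s hx hs
  obtain ⟨z, t, hz, hzs⟩ := transport_root_sq W C x₀ s hx hs
  exact eval_Ψ₂Sq_ne_sq_of_shapeIVstar_ten (placeOf 3) hπ h3 _ β₂ β₄ β₆ δ hβ₆ hδ hb₂ hb₄ hb₆ hΔ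
    _ _ hz hzs

/-- **Kodaira `II*` at `3` with `ord₃ Δ_min = 12` ⟹ `NoLocalThreeTorsionAt W 3`.**
[cite: SilvermanATAEC1994, IV.9.4 Step 10 and Table 4.1] -/
theorem noLocalThreeTorsionAt_three_of_kodairaIIstar_twelve
    (hT : W.kodairaSymbolAt (placeOf 3) = .IIstar) (hord : W.ordMinimalDiscriminant (placeOf 3) = 12) :
    NoLocalThreeTorsionAt W 3 := by
  haveI : PerfectField (IsLocalRing.ResidueField ((placeOf 3).adicCompletionIntegers ℚ)) :=
    PerfectField.ofFinite
  have h2 : ringChar (ℤ ⧸ (placeOf 3).asIdeal) ≠ 2 := by rw [ringChar_int_quot_placeOf 3]; decide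
  have hgen : natGenerator (placeOf 3) = 3 :=
    Literature.NumberTheory.EllipticCurves.Rat.natGenerator_primesEquiv_symm ⟨3, Nat.prime_three⟩
  have hπ : (placeOf 3).valuation ℚ (3 : ℚ) = exp (-1 : ℤ) := by
    have h := valuation_natGenerator_int (placeOf 3)
    rwa [hgen, Nat.cast_ofNat] at h
  have h3 : algebraMap ℚ ((placeOf 3).adicCompletion ℚ) 3 = 3 := map_ofNat _ 3
  obtain ⟨C, β₂, β₄, β₆, δ, hβ₆, hδ, hb₂, hb₄, hb₆, hΔ⟩ :=
    W.exists_variableChange_b_of_kodairaSymbolAt_wild (placeOf 3) h2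
      (Or.inr (Or.inr (Or.inr ⟨hT, rfl, rfl, rfl⟩))) hπ
  rw [hord] at hΔ
  intro x₀ s hx hs
  obtain ⟨z, t, hz, hzs⟩ := transport_root_sq W C x₀ s hx hs
  exact eval_Ψ₂Sq_ne_sq_of_shapeIIstar_twelve (placeOf 3) hπ h3 _ β₂ β₄ β₆ δ hβ₆ hδ hb₂ hb₄ hb₆ hΔ
    _ _ hz hzs

/-- **Point reading**: Kodaira `IV*` (`v = 10`) at `3` ⟹ `W(ℚ₃)[3] = 0`.
[cite: SilvermanATAEC1994, IV.9.4 Step 8] [cite: SilvermanAEC2009, Exercise 3.7 (d),(f)] -/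
theorem forall_three_nsmul_eq_zero_of_kodairaIVstar_ten
    (hT : W.kodairaSymbolAt (placeOf 3) = .IVstar) (hord : W.ordMinimalDiscriminant (placeOf 3) = 10) :
    ∀ P : (W.baseChange ℚ_[3]).toAffine.Point, 3 • P = 0 → P = 0 :=
  (noLocalThreeTorsionAt_iff_forall_three_nsmul W 3).mp
    (noLocalThreeTorsionAt_three_of_kodairaIVstar_ten W hT hord)

/-- **Point reading**: Kodaira `II*` (`v = 12`) at `3` ⟹ `W(ℚ₃)[3] = 0`.
[cite: SilvermanATAEC1994, IV.9.4 Step 10] [cite: SilvermanAEC2009, Exercise 3.7 (d),(f)] -/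
theorem forall_three_nsmul_eq_zero_of_kodairaIIstar_twelve
    (hT : W.kodairaSymbolAt (placeOf 3) = .IIstar) (hord : W.ordMinimalDiscriminant (placeOf 3) = 12) :
    ∀ P : (W.baseChange ℚ_[3]).toAffine.Point, 3 • P = 0 → P = 0 :=
  (noLocalThreeTorsionAt_iff_forall_three_nsmul W 3).mp
    (noLocalThreeTorsionAt_three_of_kodairaIIstar_twelve W hT hord)

/-- **The census spelling on the wild cell** (`ClassO6 W 3`, globally minimal): the rows with
`v₃(Δ_min) = 10` (Kodaira `IV*`, `PSKodairaDictionary.kodairaSymbolAt_of_mod_four_eq_two`) and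
`v₃(Δ_min) = 12` (Kodaira `II*`, `…_of_four_dvd`) have `NoLocalThreeTorsionAt W 3` — in particular the
`IV*` rows with `c₃ = 3` (this seat's LAW L-c3: `c₆/3⁶·Δ_min/3¹⁰ ≡ 1 (mod 3)`) have NO `ℚ₃`-rational
`3`-torsion. [cite: SilvermanATAEC1994, IV.9.4 Steps 8, 10] [cite: Papadopoulos1993, Table (p = 3)] -/
theorem noLocalThreeTorsionAt_three_of_classO6_of_ten_or_twelve [W.IsGloballyMinimal] (hO6 : ClassO6 W 3)
    (hv : padicValInt 3 W.minimalDiscriminantInt = 10 ∨ padicValInt 3 W.minimalDiscriminantInt = 12) :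
    NoLocalThreeTorsionAt W 3 := by
  obtain ⟨-, hadd, hW⟩ := hO6
  have hord : W.ordMinimalDiscriminant (placeOf 3) = padicValInt 3 W.minimalDiscriminantInt :=
    ordMinimalDiscriminant_placeOf_eq W 3
  rcases hv with h10 | h12
  · rcases PSKodairaDictionary.kodairaSymbolAt_of_mod_four_eq_two W hadd hW (by omega) with
      ⟨-, h⟩ | ⟨hK, -⟩
    · omega
    · exact noLocalThreeTorsionAt_three_of_kodairaIVstar_ten W hK (by rw [hord, h10])
  · rcases PSKodairaDictionary.kodairaSymbolAt_of_four_dvd W hadd hW ⟨3, by omega⟩ with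
      ⟨-, h⟩ | ⟨hK, -⟩
    · omega
    · exact noLocalThreeTorsionAt_three_of_kodairaIIstar_twelve W hK (by rw [hord, h12])

end Curves

end Summit.BirchSwinnertonDyer.BirchSwinnertonDyer.Theorems.PSLocalThreeTorsion

end
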